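import Mathlib
import Summits.Schanuel.Schanuel.Theses.RigidCore
import Literature.NumberTheory.Transcendental.BakerCoefficientForm
import Literature.NumberTheory.Transcendental.OneMotiveToricProofs

/-!
# Calibration C19 of line `sector-split`: the first layer of the log-free core is log-free (Baker)

Support file for crux `stmt-Schanuel-0970`
(`Summit.Schanuel.Schanuel.Theses.RigidCore.SchanuelOnLogFreeCore`, "(R)": Schanuel's statement for
`ℚ`-linearly independent tuples from the log-free core `C_EA`).  It lands the registered stub
`stub_bakerLayerOne` — calibration C19 of line `sector-split`, UNCONDITIONAL — of the line's
skeleton (`Cruxes/SchanuelOnLogFreeCore/Lines/sector_split.lean`):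

* `stub_bakerLayerOne` — for algebraic `α, β ∈ ℂ`, if `e^{α + β·2πi}` is algebraic then `α = 0` and
  `β ∈ ℚ`.  Equivalently, the first layer `E = ℚ̄ ⊕ ℚ̄·2πi` of the core meets `exp⁻¹(ℚ̄)` exactly in
  `ℚ·2πi`.  It contains Hermite–Lindemann (`β = 0`: `e^α` is transcendental for algebraic `α ≠ 0`)
  and Gel'fond–Schneider at the base `1` (`α = 0`: `e^{2πiβ}` is transcendental for `β ∈ ℚ̄ ∖ ℚ`).
* `BakerLayerOne.exp_transcendental_of_layerOne` — the contrapositive: `e^{α + β·2πi}` is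
  transcendental for algebraic `α, β` with `α ≠ 0` or `β ∉ ℚ`.

## Proof

Put `τ = 2πi` and `u = α + β τ`; `e^τ = 1` and `e^u` are algebraic.  If the pair `(τ, u)` is
`ℚ`-linearly independent, Baker's Theorem 2.1 in coefficient form
(`Literature.NumberTheory.Transcendental.baker_coeff_eq_zero`, PROVED in the tree over
`baker_holds`) kills the relation `(-α) + (-β)·τ + 1·u = 0` with algebraic coefficients, whose
coefficient at `u` is `1 ≠ 0` — contradiction (`BakerLayerOne.not_linearIndependent`).  Otherwise
`u = q τ` with `q ∈ ℚ` (`τ ≠ 0`, `LinearIndependent.pair_iff'`), so `α = (q - β) τ`; if `q ≠ β`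
then `τ = α / (q - β)` is algebraic, contradicting the transcendence of `2πi`
(`Literature.NumberTheory.Transcendental.transcendental_two_pi_I`, Lindemann 1882); hence
`β = q ∈ ℚ` and `α = 0` (`BakerLayerOne.eq_of_rat_mul`).

Sources: A. Baker, *Transcendental Number Theory* (Cambridge Univ. Press, 1975), Ch. 2, Theorem 2.1
— in the tree as the PROVED `Literature.NumberTheory.Transcendental.baker_holds` /
`baker_coeff_eq_zero`; the transcendence of `2πi` (Lindemann 1882) is the tree's
`Literature.NumberTheory.Transcendental.transcendental_two_pi_I`; otherwise Mathlib only.  Nothing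
about `C_EA` is used: this is a pure transcendence statement.
-/

noncomputable section

open Complex
open Literature.NumberTheory.Transcendental (baker_coeff_eq_zero transcendental_two_pi_I)

namespace Summit.Schanuel.Schanuel.Theorems.RigidCore

namespace BakerLayerOne

/-- `e^{2πi} = 1` is algebraic. -/
theorem isAlgebraic_exp_two_pi_I : IsAlgebraic ℚ (cexp (2 * ↑Real.pi * I)) := by
  rw [Complex.exp_two_pi_mul_I]
  exact isAlgebraic_one

/-- **Independent case** (Baker).  For algebraic `α, β` with `e^{α + β·2πi}` algebraic, the pair
`(2πi, α + β·2πi)` of logarithms of algebraic numbers is NOT `ℚ`-linearly independent: otherwise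
Baker's Theorem 2.1 in coefficient form (`baker_coeff_eq_zero`) kills the algebraic relation
`(-α) + (-β)·2πi + 1·(α + β·2πi) = 0`, whose last coefficient is `1 ≠ 0`.
[cite: BakerTNT1975, Ch. 2 Thm 2.1] -/
theorem not_linearIndependent {α β : ℂ} (hα : IsAlgebraic ℚ α) (hβ : IsAlgebraic ℚ β)
    (hexp : IsAlgebraic ℚ (cexp (α + β * (2 * ↑Real.pi * I)))) :
    ¬ LinearIndependent ℚ ![2 * ↑Real.pi * I, α + β * (2 * ↑Real.pi * I)] := by
  intro hli
  have halg : ∀ i, IsAlgebraic ℚ (cexp (![2 * ↑Real.pi * I, α + β * (2 * ↑Real.pi * I)] i)) := by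
    intro i
    fin_cases i
    · exact isAlgebraic_exp_two_pi_I
    · exact hexp
  have hcoef : ∀ i, IsAlgebraic ℚ (![-β, 1] i : ℂ) := by
    intro i
    fin_cases i
    · exact hβ.neg
    · exact isAlgebraic_one
  have hrel :
      -α + ∑ i, (![-β, 1] i : ℂ) * ![2 * ↑Real.pi * I, α + β * (2 * ↑Real.pi * I)] i = 0 := by
    simp only [Fin.sum_univ_two, Matrix.cons_val_zero, Matrix.cons_val_one]
    ring
  have hB := baker_coeff_eq_zero _ halg hli hα.neg hcoef hrel
  simpa using hB.2 1

/-- **Dependent case** (Lindemann).  If `q·2πi = α + β·2πi` with `q ∈ ℚ` and `α, β` algebraic, then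
`α = 0` and `β = q`: otherwise `q - β ≠ 0` and `2πi = α / (q - β)` would be algebraic, contradicting
`transcendental_two_pi_I`. -/
theorem eq_of_rat_mul {α β : ℂ} {q : ℚ} (hα : IsAlgebraic ℚ α) (hβ : IsAlgebraic ℚ β)
    (hq : (q : ℂ) * (2 * ↑Real.pi * I) = α + β * (2 * ↑Real.pi * I)) :
    α = 0 ∧ β = q := by
  by_cases hqβ : (q : ℂ) - β = 0
  · exact ⟨by linear_combination -hq + (2 * ↑Real.pi * I) * hqβ, by linear_combination -hqβ⟩
  · exfalso
    refine transcendental_two_pi_I ?_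
    have e : (2 * ↑Real.pi * I : ℂ) = α * ((q : ℂ) - β)⁻¹ := by
      rw [eq_mul_inv_iff_mul_eq₀ hqβ]
      linear_combination hq
    rw [e]
    exact hα.mul ((isAlgebraic_rat ℚ q).sub hβ).inv

end BakerLayerOne

/-- **C19 `stub_bakerLayerOne`: the first layer of the log-free core is log-free** (registered stub
of line `sector-split`, crux stmt-Schanuel-0970; UNCONDITIONAL).  For algebraic `α, β ∈ ℂ`, if
`e^{α + β·2πi}` is algebraic then `α = 0` and `β ∈ ℚ`: the layer `ℚ̄ ⊕ ℚ̄·2πi` meets `exp⁻¹(ℚ̄)`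
exactly in `ℚ·2πi`.  Baker's Theorem 2.1 (`baker_coeff_eq_zero`, over the tree's PROVED
`baker_holds`) at the logarithms `(2πi, α + β·2πi)` excludes their `ℚ`-independence
(`BakerLayerOne.not_linearIndependent`); a rational dependence `α + β·2πi = q·2πi` forces `β = q`,
`α = 0` by the transcendence of `2πi` (`BakerLayerOne.eq_of_rat_mul`).
[cite: BakerTNT1975, Ch. 2 Thm 2.1] -/
theorem stub_bakerLayerOne :
    ∀ α β : ℂ, IsAlgebraic ℚ α → IsAlgebraic ℚ β →
      IsAlgebraic ℚ (Complex.exp (α + β * (2 * ↑Real.pi * Complex.I))) →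
      α = 0 ∧ β ∈ Set.range ((↑) : ℚ → ℂ) := by
  intro α β hα hβ hexp
  have hdep := BakerLayerOne.not_linearIndependent hα hβ hexp
  rw [LinearIndependent.pair_iff' Complex.two_pi_I_ne_zero] at hdep
  push Not at hdep
  obtain ⟨q, hq⟩ := hdep
  rw [Rat.smul_def] at hq
  obtain ⟨h0, hβq⟩ := BakerLayerOne.eq_of_rat_mul hα hβ hq
  exact ⟨h0, q, hβq.symm⟩

namespace BakerLayerOne

/-- Contrapositive of `stub_bakerLayerOne`: for algebraic `α, β` with `α ≠ 0` or `β ∉ ℚ`, the number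
`e^{α + β·2πi}` is transcendental — Hermite–Lindemann (`β = 0`) and Gel'fond–Schneider at the base
`1` (`α = 0`) in one statement. [cite: BakerTNT1975, Ch. 2 Thm 2.1] -/
theorem exp_transcendental_of_layerOne {α β : ℂ} (hα : IsAlgebraic ℚ α) (hβ : IsAlgebraic ℚ β)
    (h : α ≠ 0 ∨ β ∉ Set.range ((↑) : ℚ → ℂ)) :
    Transcendental ℚ (Complex.exp (α + β * (2 * ↑Real.pi * Complex.I))) := by
  intro hexp
  obtain ⟨h0, hβq⟩ := stub_bakerLayerOne α β hα hβ hexp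
  exact h.elim (fun hα0 => hα0 h0) (fun hβ' => hβ' hβq)

end BakerLayerOne

end Summit.Schanuel.Schanuel.Theorems.RigidCore
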